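import Literature.Barriers.FinalStateConjecture.KleinGordonModeConstructionProofs
import Literature.Barriers.FinalStateConjecture.KleinGordonUnstableModes
import HarnessLib

/-!
# Barrier catalogue `FinalStateConjecture`: the narrowed Klein–Gordon superradiance barrier —
# reduction of `KleinGordonSuperradiantInstabilityNarrow` to the frontier fact of the mode construction
(`Literature/Barriers/FinalStateConjecture/`, D-0021, D-0014; family `gr`; namespace
`Literature.Barriers.FinalStateConjecture`)

`KleinGordonSuperradiantInstability.lean` states the narrowed barrier
`KleinGordonSuperradiantInstabilityNarrow` (Shlapentokh-Rothman, CMP 329 (2014), Thm. 1.1 with its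
mass clause, read at small spin AND small mass) and proves it from the original fact
`KleinGordonSuperradiantInstability` (`KleinGordonSuperradiantInstabilityNarrow.of`, via
`.small_spin_small_mass`). The sibling files reduce the original fact, through the profile form
`ShlapentokhRothman2014_unstableModeProfile` (`KleinGordonSuperradiantInstabilityProofs.lean`,
`KleinGordonSuperradiantInstability.of_unstableModeProfile`) and Carter separation on the
Kerr–Schild leaf (`CarterSeparationKSLeaf_holds`, `KleinGordonModeConstructionProofs.lean`), to the
single named fact `ShlapentokhRothman2014_separatedMode` (`KleinGordonModeConstruction.lean`: SR's
Thm. 1.2 in the printed separated variables, read at one small `ε > 0`).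

This file records the composite reductions for the NARROWED declaration, so that it is discharged
in one line by whichever of the three upstream statements lands first:

* `KleinGordonSuperradiantInstabilityNarrow.of_unstableModeProfile :
    ShlapentokhRothman2014_unstableModeProfile → KleinGordonSuperradiantInstabilityNarrow`;
* `KleinGordonSuperradiantInstabilityNarrow.of_separatedMode :
    ShlapentokhRothman2014_separatedMode → KleinGordonSuperradiantInstabilityNarrow`.

Nothing is assumed and no statement is introduced: both are proved compositions of theorems already
in the tree. The discharge `KleinGordonSuperradiantInstabilityNarrow_holds` — planned here "once
`ShlapentokhRothman2014_separatedMode` (equivalently `KleinGordonSuperradiantInstability`) is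
proved" — is appended at the end, now that `KleinGordonUnstableModes.lean` proves both
(`KleinGordonSuperradiantInstability_holds`, `ShlapentokhRothman2014_separatedMode_holds`); it is the
one-line composition with `KleinGordonSuperradiantInstabilityNarrow.of`.

## References

* Y. Shlapentokh-Rothman, *Exponentially growing finite energy solutions for the Klein–Gordon
  equation on sub-extremal Kerr spacetimes*, Comm. Math. Phys. 329 (2014) 859–891,
  arXiv:1302.3448: Thm. 1.1 with the mass clause "For every non-zero integer `m`, `μ` can be chosen
  arbitrarily close to `|am|/(2Mr₊)`. In particular, `μ` can be made arbitrarily small as `a → 0`"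
  (p. 3 of the held copy `paper:arxiv-1302.3448`), Thm. 1.2 (p. 5), §2 (mode solutions) (key
  `ShlapentokhRothman2014KleinGordon`).
-/

noncomputable section

namespace Literature.Barriers.FinalStateConjecture

/-- **Profile form ⟹ the narrowed barrier.** The data `(μ, ω, Φ)` of
`ShlapentokhRothman2014_unstableModeProfile` give the original barrier fact
(`KleinGordonSuperradiantInstability.of_unstableModeProfile`: the real mode `Re(e^{−iωt_KS}Φ)`), whence
the narrowed one (`KleinGordonSuperradiantInstabilityNarrow.of`: the mass clause at `m = 1` and spin
`a = min(a₀/2, M/2, M²μ₀)`). Shlapentokh-Rothman, CMP 329 (2014), Thm. 1.1 (p. 3, with "In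
particular, `μ` can be made arbitrarily small as `a → 0`") from Thm. 1.2 (p. 5).
[cite: ShlapentokhRothman2014KleinGordon, Thm. 1.1 (p. 3) and Thm. 1.2 (p. 5)] -/
theorem KleinGordonSuperradiantInstabilityNarrow.of_unstableModeProfile
    (h : ShlapentokhRothman2014_unstableModeProfile) : KleinGordonSuperradiantInstabilityNarrow :=
  KleinGordonSuperradiantInstabilityNarrow.of
    (KleinGordonSuperradiantInstability.of_unstableModeProfile h)

/-- **Separated mode theorem ⟹ the narrowed barrier.** With Carter separation on the Kerr–Schild
leaf discharged (`CarterSeparationKSLeaf_holds`), the narrowed barrier rests on the single named fact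
`ShlapentokhRothman2014_separatedMode` (SR's Thm. 1.2 in the printed separated variables
`e^{−iωt}e^{imφ}S(θ)R(r)`): compose `KleinGordonSuperradiantInstability.of_separatedMode` with
`KleinGordonSuperradiantInstabilityNarrow.of`. Shlapentokh-Rothman, CMP 329 (2014), Thm. 1.1 (p. 3)
from Thm. 1.2 (p. 5) and §2. [cite: ShlapentokhRothman2014KleinGordon, Thm. 1.1 (p. 3), Thm. 1.2 (p. 5) and §2] -/
theorem KleinGordonSuperradiantInstabilityNarrow.of_separatedMode
    (hM : ShlapentokhRothman2014_separatedMode) : KleinGordonSuperradiantInstabilityNarrow :=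
  KleinGordonSuperradiantInstabilityNarrow.of
    (KleinGordonSuperradiantInstability.of_separatedMode hM)

/-! ### The discharge -/

/-- **`KleinGordonSuperradiantInstabilityNarrow` holds** — the narrowed barrier (Shlapentokh-Rothman's
Thm. 1.1 with its mass clause, read at small spin and small mass, `m = 1`): the discharged barrier
`KleinGordonSuperradiantInstability_holds` (`KleinGordonUnstableModes.lean`: SR's mode construction,
Thms. 1.1–1.2) through the proved narrowing `KleinGordonSuperradiantInstabilityNarrow.of`.
[cite: ShlapentokhRothman2014KleinGordon, Thm. 1.1 (p. 3) and Thm. 1.2 (p. 5)] -/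
theorem KleinGordonSuperradiantInstabilityNarrow_holds : KleinGordonSuperradiantInstabilityNarrow :=
  KleinGordonSuperradiantInstabilityNarrow.of KleinGordonSuperradiantInstability_holds

end Literature.Barriers.FinalStateConjecture

end
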